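import Summits.AtomisticToContinuum.FouriersLaw.Theorems.HiddenChargeMazurNoOddChargeMoments

/-!
# No odd small-range charges for the pinned anharmonic chain — momentum orthogonality

Support file for item `stmt-AtomisticToContinuum-13514` (`HiddenChargeMazur.NoOddChargeSmallRange`),
analytic half: `N`-uniform statics of the Gibbs weight `e^{-H/T}` of `pinnedChain ω₂ lam β γ`.

`∫ p_k G ρ = 0` for `p_k`-independent `G` (integration by parts in `p_k`); an elementary Cauchy–Schwarz
inequality; 2-site observables `H2(q_a,p_a,q_b,p_b)` with `H2² ≤ A(1 + ∑ u⁸)` are energy-dominated; bonds not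
touching `a, b` are orthogonal to them (`pinnedChain_integral_bondCurrent_mul_twoSite_eq_zero`).
-/

noncomputable section

open MeasureTheory
open scoped BigOperators
open Literature.MathematicalPhysics.KineticTheory.HeatConduction
open Summit.AtomisticToContinuum.FouriersLaw.Theorems.SubdiffusiveBondHeat
open Summit.AtomisticToContinuum.FouriersLaw.Theorems.LightConeBondHeat

namespace Summit.AtomisticToContinuum.FouriersLaw.Theorems.NoOddCharge

variable {N : ℕ}

section Pinned

variable {ω₂ lam β : ℝ}

/-! ### Momentum orthogonality: `∫ p_k G e^{-H/T} = 0` for `p_k`-independent `G` -/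

/-- **Momentum orthogonality.** If `G` is continuous, dominated by a power of the energy and independent of
`p_k`, then `∫ p_k G e^{-H/T} = 0` (one integration by parts in `p_k`; the momenta are centred Gaussians
independent of everything else under `e^{-H/T}`). [folklore] -/
theorem pinnedChain_integral_momentum_mul_eq_zero (hω : 0 < ω₂) (hl : 0 ≤ lam) (hβ : 0 ≤ β) (γ : ℝ)
    (N : ℕ) {T : ℝ} (hT : 0 < T) (k : Fin N) {G : PhaseSpace N → ℝ} (hG : Continuous G) {C : ℝ} (m : ℕ)
    (hle : ∀ x, |G x| ≤ C * (1 + (pinnedChain ω₂ lam β γ).hamiltonian N x) ^ m)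
    (hinv : ∀ (x : PhaseSpace N) (t : ℝ), G (x.1, Function.update x.2 k t) = G x) :
    ∫ x, x.2 k * G x * (pinnedChain ω₂ lam β γ).gibbsDensity N T x = 0 := by
  set P := pinnedChain ω₂ lam β γ with hP
  have hGd : ∀ x : PhaseSpace N, HasLineDerivAt ℝ G 0 x ((0, Pi.single k 1) : PhaseSpace N) := by
    intro x
    unfold HasLineDerivAt
    have hc : (fun t : ℝ => G (x + t • ((0, Pi.single k 1) : PhaseSpace N))) = fun _ => G x := by
      funext t
      rw [show x + t • ((0, Pi.single k 1) : PhaseSpace N) = (x.1, Function.update x.2 k (x.2 k + t)) from ?_]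
      · exact hinv x _
      · refine Prod.ext (by simp) ?_
        show x.2 + t • Pi.single k 1 = Function.update x.2 k (x.2 k + t)
        exact add_smul_single_eq_update x.2 t k
    rw [hc]
    exact hasDerivAt_const _ _
  have hGint : Integrable fun x => G x * P.gibbsDensity N T x :=
    pinnedChain_integrable_mul_gibbsDensity_of_le_pow hω hl hβ γ N hT m hG hle
  have hFg' : Integrable fun x => G x * (-(x.2 k / T) * P.gibbsDensity N T x) := by
    have h := pinnedChain_integrable_mul_gibbsDensity_of_le_pow hω hl hβ γ N hT (m + 2)
      (g := fun x => G x * x.2 k) (hG.mul (by fun_prop)) (C := C * 4) fun x => ?_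
    · refine (h.const_mul (-T⁻¹)).congr (Filter.Eventually.of_forall fun x => ?_)
      simp only
      ring
    · rw [abs_mul]
      have h1 := hle x
      have h2 := pinnedChain_abs_momentum_pow_le_pow hω.le hl hβ γ N x k 1
      rw [pow_one, pow_one, mul_one] at h2
      have hH0 := pinnedChain_hamiltonian_nonneg hω.le hl hβ γ N x
      have hC0 : 0 ≤ C * (1 + P.hamiltonian N x) ^ m := (abs_nonneg _).trans h1
      calc |G x| * |x.2 k| ≤ (C * (1 + P.hamiltonian N x) ^ m) * (4 * (1 + P.hamiltonian N x) ^ 2) :=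
            mul_le_mul h1 h2 (abs_nonneg _) hC0
        _ = C * 4 * (1 + P.hamiltonian N x) ^ (m + 2) := by ring
  have e := integral_mul_eq_neg_of_hasLineDerivAt_of_integrable
    (F := G) (F' := fun _ => (0:ℝ)) (g := P.gibbsDensity N T)
    (g' := fun x => -(x.2 k / T) * P.gibbsDensity N T x)
    (v := ((0, Pi.single k 1) : PhaseSpace N)) (by simp) hFg' hGint hGd
    (fun x => P.hasLineDerivAt_gibbsDensity (P.hasLineDerivAt_hamiltonian_unitP N x k))
  simp only [zero_mul, integral_zero, neg_zero] at e
  have e2 : ∫ x, G x * (-(x.2 k / T) * P.gibbsDensity N T x) =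
      -T⁻¹ * ∫ x, x.2 k * G x * P.gibbsDensity N T x := by
    rw [← integral_const_mul]
    exact integral_congr_ae (Filter.Eventually.of_forall fun x => by ring)
  rw [e2] at e
  have hTne : T⁻¹ ≠ 0 := inv_ne_zero hT.ne'
  have := mul_eq_zero.mp e
  rcases this with h | h
  · exact absurd h (neg_ne_zero.mpr hTne)
  · exact h

/-! ### An elementary Cauchy–Schwarz inequality for integrals -/

/-- **Cauchy–Schwarz.** `(∫ f g dμ)² ≤ (∫ f² dμ)(∫ g² dμ)` when `f², g², fg` are integrable. [folklore] -/
theorem sq_integral_mul_le {α : Type*} [MeasurableSpace α] (μ : Measure α) {f g : α → ℝ}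
    (hf : Integrable (fun x => f x ^ 2) μ) (hg : Integrable (fun x => g x ^ 2) μ)
    (hfg : Integrable (fun x => f x * g x) μ) :
    (∫ x, f x * g x ∂μ) ^ 2 ≤ (∫ x, f x ^ 2 ∂μ) * ∫ x, g x ^ 2 ∂μ := by
  set A := ∫ x, f x ^ 2 ∂μ
  set B := ∫ x, f x * g x ∂μ
  set Cc := ∫ x, g x ^ 2 ∂μ
  have hquad : ∀ t : ℝ, 0 ≤ A - 2 * t * B + t ^ 2 * Cc := by
    intro t
    have h := integral_nonneg (μ := μ) (f := fun x => (f x - t * g x) ^ 2) fun x => sq_nonneg _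
    have hexp : ∫ x, (f x - t * g x) ^ 2 ∂μ = A - 2 * t * B + t ^ 2 * Cc := by
      have : (fun x => (f x - t * g x) ^ 2) = fun x => f x ^ 2 - (2 * t) * (f x * g x) + t ^ 2 * g x ^ 2 := by
        funext x; ring
      rw [this, integral_add, integral_sub, integral_const_mul, integral_const_mul]
      · exact hf
      · exact hfg.const_mul _
      · exact hf.sub (hfg.const_mul _)
      · exact hg.const_mul _
    rw [hexp] at h
    exact h
  have hA : 0 ≤ A := integral_nonneg fun x => sq_nonneg _
  have hC : 0 ≤ Cc := integral_nonneg fun x => sq_nonneg _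
  rcases hC.lt_or_eq with hCpos | hC0
  · have h := hquad (B / Cc)
    have : A - 2 * (B / Cc) * B + (B / Cc) ^ 2 * Cc = A - B ^ 2 / Cc := by
      field_simp
      ring
    rw [this] at h
    have h2 : B ^ 2 / Cc ≤ A := by linarith
    rwa [div_le_iff₀ hCpos] at h2
  · -- `C = 0`: then `B = 0`
    have hB : B = 0 := by
      by_contra hB
      have h := hquad ((A + 1) / (2 * B))
      rw [← hC0] at h
      have : A - 2 * ((A + 1) / (2 * B)) * B + ((A + 1) / (2 * B)) ^ 2 * 0 = -1 := by
        field_simp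
        ring
      linarith
    rw [hB, ← hC0]
    simp

/-! ### Boundary observables built from a 2-site function of four coordinates -/

/-- The 2-site observable `H2(q_a, p_a, q_b, p_b)` on phase space. [folklore] -/
theorem continuous_twoSite {H2 : (Fin 4 → ℝ) → ℝ} (hHc : Continuous H2) (a b : Fin N) :
    Continuous fun z : PhaseSpace N => H2 ![z.1 a, z.2 a, z.1 b, z.2 b] := by
  refine hHc.comp ?_
  refine continuous_pi fun i => ?_
  fin_cases i <;> simp <;> fun_prop

/-- Energy domination of the square of a 2-site observable with `H2² ≤ A(1 + ∑ u⁸)`: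
`H2(z_a,z_b)² ≤ A (1 + 2(1+4/lam)⁸ + 2·4⁸) (1+H)^16`. [folklore] -/
theorem pinnedChain_twoSite_sq_le (hω : 0 ≤ ω₂) (hl : 0 < lam) (hβ : 0 ≤ β) (γ : ℝ) (N : ℕ)
    {H2 : (Fin 4 → ℝ) → ℝ} {A : ℝ} (hA : 0 ≤ A)
    (hHb : ∀ u, (H2 u) ^ 2 ≤ A * (1 + u 0 ^ 8 + u 1 ^ 8 + u 2 ^ 8 + u 3 ^ 8)) (a b : Fin N) (z : PhaseSpace N) :
    (H2 ![z.1 a, z.2 a, z.1 b, z.2 b]) ^ 2 ≤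
      A * (1 + 2 * (1 + 4 / lam) ^ 8 + 2 * 4 ^ 8) * (1 + (pinnedChain ω₂ lam β γ).hamiltonian N z) ^ 16 := by
  set Hm := (pinnedChain ω₂ lam β γ).hamiltonian N z with hHm
  have hH0 : 0 ≤ Hm := pinnedChain_hamiltonian_nonneg hω hl.le hβ γ N z
  have h1 : (1:ℝ) ≤ (1 + Hm) ^ 16 := one_le_pow₀ (by linarith)
  have hq : ∀ i : Fin N, z.1 i ^ 8 ≤ (1 + 4 / lam) ^ 8 * (1 + Hm) ^ 16 := by
    intro i
    have h := pinnedChain_abs_position_pow_le_pow hω hl hβ γ N z i 8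
    rw [abs_of_nonneg (by positivity)] at h
    refine h.trans ?_
    have : (1 + Hm) ^ 8 ≤ (1 + Hm) ^ 16 := pow_le_pow_right₀ (by linarith) (by norm_num)
    exact mul_le_mul_of_nonneg_left this (by positivity)
  have hp : ∀ i : Fin N, z.2 i ^ 8 ≤ 4 ^ 8 * (1 + Hm) ^ 16 := by
    intro i
    have h := pinnedChain_abs_momentum_pow_le_pow hω hl.le hβ γ N z i 8
    rw [abs_of_nonneg (by positivity)] at h
    simpa using h
  have hu := hHb ![z.1 a, z.2 a, z.1 b, z.2 b]
  simp only [Matrix.cons_val_zero, Matrix.cons_val_one, Matrix.cons_val] at hu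
  refine hu.trans ?_
  have hsum : 1 + z.1 a ^ 8 + z.2 a ^ 8 + z.1 b ^ 8 + z.2 b ^ 8 ≤
      (1 + 2 * (1 + 4 / lam) ^ 8 + 2 * 4 ^ 8) * (1 + Hm) ^ 16 := by
    nlinarith [hq a, hq b, hp a, hp b]
  calc A * (1 + z.1 a ^ 8 + z.2 a ^ 8 + z.1 b ^ 8 + z.2 b ^ 8)
      ≤ A * ((1 + 2 * (1 + 4 / lam) ^ 8 + 2 * 4 ^ 8) * (1 + Hm) ^ 16) := mul_le_mul_of_nonneg_left hsum hA
    _ = _ := by ring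

/-- `|H2(z_a,z_b)| ≤ √(A K) (1+H)⁸`. [folklore] -/
theorem pinnedChain_abs_twoSite_le (hω : 0 ≤ ω₂) (hl : 0 < lam) (hβ : 0 ≤ β) (γ : ℝ) (N : ℕ)
    {H2 : (Fin 4 → ℝ) → ℝ} {A : ℝ} (hA : 0 ≤ A)
    (hHb : ∀ u, (H2 u) ^ 2 ≤ A * (1 + u 0 ^ 8 + u 1 ^ 8 + u 2 ^ 8 + u 3 ^ 8)) (a b : Fin N) (z : PhaseSpace N) :
    |H2 ![z.1 a, z.2 a, z.1 b, z.2 b]| ≤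
      Real.sqrt (A * (1 + 2 * (1 + 4 / lam) ^ 8 + 2 * 4 ^ 8)) * (1 + (pinnedChain ω₂ lam β γ).hamiltonian N z) ^ 8 := by
  have h := pinnedChain_twoSite_sq_le hω hl hβ γ N hA hHb a b z
  have hH0 := pinnedChain_hamiltonian_nonneg hω hl.le hβ γ N z
  rw [← Real.sqrt_sq (abs_nonneg _), sq_abs]
  calc Real.sqrt ((H2 ![z.1 a, z.2 a, z.1 b, z.2 b]) ^ 2)
      ≤ Real.sqrt (A * (1 + 2 * (1 + 4 / lam) ^ 8 + 2 * 4 ^ 8) *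
          (1 + (pinnedChain ω₂ lam β γ).hamiltonian N z) ^ 16) := Real.sqrt_le_sqrt h
    _ = _ := by
      rw [Real.sqrt_mul (by positivity), show (16:ℕ) = 2 * 8 from rfl, pow_mul',
        Real.sqrt_sq (by positivity)]

/-- **Orthogonality of far bonds.** If the bond `(k, k+1)` does not touch the sites `a, b`, the bond current is
orthogonal to every 2-site observable at `a, b`: `∫ j_k H2(z_a,z_b) e^{-H/T} = 0`. [folklore] -/
theorem pinnedChain_integral_bondCurrent_mul_twoSite_eq_zero (hω : 0 < ω₂) (hl : 0 < lam) (hβ : 0 ≤ β) (γ : ℝ)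
    (N : ℕ) {T : ℝ} (hT : 0 < T) {H2 : (Fin 4 → ℝ) → ℝ} (hHc : Continuous H2) {A : ℝ} (hA : 0 ≤ A)
    (hHb : ∀ u, (H2 u) ^ 2 ≤ A * (1 + u 0 ^ 8 + u 1 ^ 8 + u 2 ^ 8 + u 3 ^ 8)) (a b k : Fin N)
    (hka : k ≠ a) (hkb : k ≠ b) (hk1a : k.val + 1 ≠ a.val) (hk1b : k.val + 1 ≠ b.val) :
    ∫ z, (pinnedChain ω₂ lam β γ).bondCurrent N k z * H2 ![z.1 a, z.2 a, z.1 b, z.2 b] *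
      (pinnedChain ω₂ lam β γ).gibbsDensity N T z = 0 := by
  set P := pinnedChain ω₂ lam β γ with hP
  by_cases hk : k.val + 1 < N
  · set l : Fin N := ⟨k.val + 1, hk⟩ with hl'
    have hla : l ≠ a := fun h => hk1a (by rw [← h])
    have hlb : l ≠ b := fun h => hk1b (by rw [← h])
    -- the weight `G = V'(q_l - q_k) H2(z_a, z_b)` is continuous, dominated, independent of `p_k`, `p_l`
    set G : PhaseSpace N → ℝ := fun z => deriv P.V (z.1 l - z.1 k) * H2 ![z.1 a, z.2 a, z.1 b, z.2 b] with hG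
    have hGc : Continuous G := by
      simp only [hG, hP, pinnedChain_deriv_V]
      exact (by fun_prop : Continuous fun z : PhaseSpace N => (z.1 l - z.1 k) + β * (z.1 l - z.1 k) ^ 3).mul
        (continuous_twoSite hHc a b)
    have hGle : ∀ z, |G z| ≤ (3 + β) * Real.sqrt (A * (1 + 2 * (1 + 4 / lam) ^ 8 + 2 * 4 ^ 8)) *
        (1 + P.hamiltonian N z) ^ 9 := by
      intro z
      simp only [hG]
      rw [abs_mul]
      have hH0 := pinnedChain_hamiltonian_nonneg hω.le hl.le hβ γ N z
      have hV : |deriv P.V (z.1 l - z.1 k)| ≤ (3 + β) * (1 + P.hamiltonian N z) := by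
        have := (pinnedChain_bond_bounds hω.le hl.le hβ γ N z (k := k) (l := l) rfl).2.2
        rw [← sq_abs, ← mul_pow] at this
        exact abs_le_of_sq_le_sq' this (by positivity) |>.2
      have hH := pinnedChain_abs_twoSite_le hω.le hl hβ γ N hA hHb a b z
      calc |deriv P.V (z.1 l - z.1 k)| * |H2 ![z.1 a, z.2 a, z.1 b, z.2 b]|
          ≤ ((3 + β) * (1 + P.hamiltonian N z)) *
            (Real.sqrt (A * (1 + 2 * (1 + 4 / lam) ^ 8 + 2 * 4 ^ 8)) * (1 + P.hamiltonian N z) ^ 8) :=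
            mul_le_mul hV hH (abs_nonneg _) (by positivity)
        _ = _ := by ring
    have hinv_k : ∀ (z : PhaseSpace N) (t : ℝ), G (z.1, Function.update z.2 k t) = G z := by
      intro z t
      simp only [hG, Function.update_of_ne hka.symm, Function.update_of_ne hkb.symm]
    have hinv_l : ∀ (z : PhaseSpace N) (t : ℝ), G (z.1, Function.update z.2 l t) = G z := by
      intro z t
      simp only [hG, Function.update_of_ne hla.symm, Function.update_of_ne hlb.symm]
    have e1 := pinnedChain_integral_momentum_mul_eq_zero hω hl.le hβ γ N hT k hGc 9 hGle hinv_k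
    have e2 := pinnedChain_integral_momentum_mul_eq_zero hω hl.le hβ γ N hT l hGc 9 hGle hinv_l
    have hsplit : (fun z => P.bondCurrent N k z * H2 ![z.1 a, z.2 a, z.1 b, z.2 b] * P.gibbsDensity N T z) =
        fun z => (-1/2 : ℝ) * (z.2 k * G z * P.gibbsDensity N T z) +
          (-1/2 : ℝ) * (z.2 l * G z * P.gibbsDensity N T z) := by
      funext z
      rw [bondCurrent_eq_of_lt P hk z]
      simp only [hG]
      ring
    have hI : ∀ i : Fin N, Integrable fun z => z.2 i * G z * P.gibbsDensity N T z := by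
      intro i
      have h := pinnedChain_integrable_mul_gibbsDensity_of_le_pow hω hl.le hβ γ N hT (9 + 2)
        (g := fun z => z.2 i * G z) ((by fun_prop : Continuous fun z : PhaseSpace N => z.2 i).mul hGc)
        (C := 4 * ((3 + β) * Real.sqrt (A * (1 + 2 * (1 + 4 / lam) ^ 8 + 2 * 4 ^ 8)))) fun z => ?_
      · exact h
      · rw [abs_mul]
        have h2 := pinnedChain_abs_momentum_pow_le_pow hω.le hl.le hβ γ N z i 1
        rw [pow_one, pow_one, mul_one] at h2
        have hH0 := pinnedChain_hamiltonian_nonneg hω.le hl.le hβ γ N z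
        calc |z.2 i| * |G z| ≤ (4 * (1 + P.hamiltonian N z) ^ 2) *
              ((3 + β) * Real.sqrt (A * (1 + 2 * (1 + 4 / lam) ^ 8 + 2 * 4 ^ 8)) * (1 + P.hamiltonian N z) ^ 9) :=
              mul_le_mul h2 (hGle z) (abs_nonneg _) (by positivity)
          _ = _ := by ring
    rw [hsplit, integral_add ((hI k).const_mul _) ((hI l).const_mul _), integral_const_mul, integral_const_mul,
      e1, e2]
    ring
  · -- no bond
    have hj : ∀ z, P.bondCurrent N k z = 0 := by
      intro z
      unfold OscillatorChain.bondCurrent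
      refine Finset.sum_eq_zero fun j _ => ?_
      rw [if_neg]
      intro hv
      exact hk (hv ▸ j.isLt)
    simp [hj]

end Pinned

end Summit.AtomisticToContinuum.FouriersLaw.Theorems.NoOddCharge

end
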